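import Mathlib

/-!
# The Bernstein identity in Hausdorff's construction of the representing measure

For a real sequence `a : ℕ → ℝ` and `N : ℕ`, Hausdorff's proof of the moment theorem on `[0,1]`
(a completely monotone sequence is the moment sequence of a positive measure on `[0,1]`) uses the
weights
`λ_{N,j} = C(N,j) Σ_{i ≤ N-j} (-1)^i C(N-j,i) a(j+i) = C(N,j) ((I - T)^{N-j} a)(j)` (`T` the shift),
i.e. the values of the "moment functional" `X^m ↦ a m` on the Bernstein polynomials
`C(N,j) X^j (1-X)^{N-j}`. The purely algebraic identity proved here,

`Σ_{j ≤ N} [C(j,n) / C(N,n)] λ_{N,j} = a n` for `n ≤ N`,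

valid for every real sequence `a`, says that the discrete measures `Σ_j λ_{N,j} δ_{j/N}` have the
exact "binomial moments" `a n`; it is the moment functional applied to the Bernstein identity
`Σ_j [C(j,n) / C(N,n)] C(N,j) X^j (1-X)^{N-j} = X^n`.

* `bernsteinWeights_sum_descFactorial` — the identity.

## References

* C. Berg, J. P. R. Christensen, P. Ressel, *Harmonic Analysis on Semigroups*, Graduate Texts in
  Mathematics 100, Springer (1984), Ch. 4, Prop. 6.11 (proof). [BergChristensenRessel1984]
* F. Hausdorff, Summationsmethoden und Momentfolgen I, *Math. Z.* 9 (1921), 74–109; folklore.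
-/

noncomputable section

open MeasureTheory Set Filter Topology Polynomial

namespace Literature.MeasureTheory.Integral

namespace HausdorffMomentBernsteinIdentity

/-! ## 1. Polynomial identities -/

/-- `X^j (1 - X)^k = Σ_{i ≤ k} (-1)^i C(k,i) X^{j+i}`. [folklore] -/
theorem X_pow_mul_one_sub_X_pow (j k : ℕ) :
    (X : ℝ[X]) ^ j * (1 - X) ^ k =
      ∑ i ∈ Finset.range (k + 1), ((-1 : ℝ) ^ i * (k.choose i : ℝ)) • (X : ℝ[X]) ^ (j + i) := by
  rw [sub_eq_neg_add, add_pow, Finset.mul_sum]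
  refine Finset.sum_congr rfl fun i _ => ?_
  rw [one_pow, mul_one, neg_pow, pow_add, smul_eq_C_mul, map_mul, map_pow, map_neg, map_one,
    map_natCast]
  ring

/-- `X^m = Σ_{l ≤ K} C(K,l) X^{m+l} (1 - X)^{K-l}`, i.e. `X^m (X + (1 - X))^K = X^m`. [folklore] -/
theorem X_pow_eq_sum_choose_smul (m K : ℕ) :
    (X : ℝ[X]) ^ m = ∑ l ∈ Finset.range (K + 1),
      (K.choose l : ℝ) • ((X : ℝ[X]) ^ (m + l) * (1 - X) ^ (K - l)) := by
  have h : (X : ℝ[X]) + (1 - X) = 1 := by ring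
  calc (X : ℝ[X]) ^ m = X ^ m * (X + (1 - X)) ^ K := by rw [h, one_pow, mul_one]
    _ = ∑ l ∈ Finset.range (K + 1),
          (K.choose l : ℝ) • ((X : ℝ[X]) ^ (m + l) * (1 - X) ^ (K - l)) := by
      rw [add_pow, Finset.mul_sum]
      refine Finset.sum_congr rfl fun l _ => ?_
      rw [pow_add, smul_eq_C_mul, map_natCast]
      ring

/-- `[C(n+l,n) / C(N,n)] C(N,n+l) = C(N-n,l)` for `n ≤ N`. [folklore] -/
theorem choose_div_choose_mul_choose (N n l : ℕ) (hn : n ≤ N) :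
    ((n + l).choose n : ℝ) / (N.choose n : ℝ) * (N.choose (n + l) : ℝ) =
      ((N - n).choose l : ℝ) := by
  have hpos : (N.choose n : ℝ) ≠ 0 := Nat.cast_ne_zero.mpr (Nat.choose_pos hn).ne'
  rw [div_mul_eq_mul_div, div_eq_iff hpos]
  have h : (N.choose (n + l) : ℝ) * ((n + l).choose n : ℝ) =
      (N.choose n : ℝ) * ((N - n).choose l : ℝ) := by
    have h' := Nat.choose_mul (n := N) (Nat.le_add_right n l)
    rw [Nat.add_sub_cancel_left] at h'
    exact_mod_cast h'
  linear_combination h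

/-- The Bernstein identity `Σ_{j ≤ N} [C(j,n) / C(N,n)] C(N,j) X^j (1 - X)^{N-j} = X^n` for `n ≤ N`.
[folklore] -/
theorem sum_bernstein_smul_eq_X_pow (N n : ℕ) (hn : n ≤ N) :
    ∑ j ∈ Finset.range (N + 1), ((j.choose n : ℝ) / (N.choose n : ℝ)) •
      ((N.choose j : ℝ) • ((X : ℝ[X]) ^ j * (1 - X) ^ (N - j))) = X ^ n := by
  have hsplit : N + 1 = n + (N - n + 1) := by omega
  have h0 : ∑ j ∈ Finset.range n, ((j.choose n : ℝ) / (N.choose n : ℝ)) •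
      ((N.choose j : ℝ) • ((X : ℝ[X]) ^ j * (1 - X) ^ (N - j))) = 0 :=
    Finset.sum_eq_zero fun j hj => by
      rw [Nat.choose_eq_zero_of_lt (Finset.mem_range.mp hj), Nat.cast_zero, zero_div, zero_smul]
  rw [hsplit, Finset.sum_range_add, h0, zero_add, X_pow_eq_sum_choose_smul n (N - n)]
  refine Finset.sum_congr rfl fun l _ => ?_
  rw [smul_smul, choose_div_choose_mul_choose N n l hn, Nat.sub_add_eq]

/-! ## 2. The moment functional -/

/-- The moment functional of a sequence `a`: a linear form on `ℝ[X]` with `X^k ↦ a k`. [folklore] -/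
theorem exists_linearMap_X_pow (a : ℕ → ℝ) : ∃ L : ℝ[X] →ₗ[ℝ] ℝ, ∀ k : ℕ, L (X ^ k) = a k := by
  refine ⟨Polynomial.lsum fun m => LinearMap.id.smulRight (a m), fun k => ?_⟩
  rw [Polynomial.lsum_apply, X_pow_eq_monomial, sum_monomial_index]
  · simp
  · simp

/-- The moment functional on `X^j (1 - X)^k`: `Σ_{i ≤ k} (-1)^i C(k,i) a(j+i)`. [folklore] -/
theorem linearMap_X_pow_mul_one_sub_X_pow (L : ℝ[X] →ₗ[ℝ] ℝ) (a : ℕ → ℝ)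
    (hL : ∀ k : ℕ, L (X ^ k) = a k) (j k : ℕ) :
    L ((X : ℝ[X]) ^ j * (1 - X) ^ k) =
      ∑ i ∈ Finset.range (k + 1), (-1 : ℝ) ^ i * (k.choose i : ℝ) * a (j + i) := by
  rw [X_pow_mul_one_sub_X_pow, map_sum]
  refine Finset.sum_congr rfl fun i _ => ?_
  rw [map_smul, hL, smul_eq_mul]

end HausdorffMomentBernsteinIdentity

/-- **Hausdorff's Bernstein identity.** For every real sequence `a` and `n ≤ N`,
`Σ_{j ≤ N} [C(j,n) / C(N,n)] · C(N,j) Σ_{i ≤ N-j} (-1)^i C(N-j,i) a(j+i) = a n`: the discrete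
measures of Hausdorff's construction, with weights `λ_{N,j} = C(N,j) ((I - T)^{N-j} a)(j)`, have the
exact binomial moments `a n`. It is the moment functional `X^m ↦ a m` applied to the Bernstein
identity `Σ_j [C(j,n) / C(N,n)] C(N,j) X^j (1-X)^{N-j} = X^n`.
[cite: BergChristensenRessel1984, Ch. 4, Prop. 6.11 (proof)] -/
theorem bernsteinWeights_sum_descFactorial (a : ℕ → ℝ) (N n : ℕ) (hn : n ≤ N) :
    ∑ j ∈ Finset.range (N + 1), ((j.choose n : ℝ) / (N.choose n : ℝ)) *
      ((N.choose j : ℝ) * ∑ i ∈ Finset.range (N - j + 1), (-1 : ℝ) ^ i * ((N - j).choose i : ℝ) * a (j + i))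
      = a n := by
  obtain ⟨L, hL⟩ := HausdorffMomentBernsteinIdentity.exists_linearMap_X_pow a
  rw [← hL n, ← HausdorffMomentBernsteinIdentity.sum_bernstein_smul_eq_X_pow N n hn, map_sum]
  refine Finset.sum_congr rfl fun j _ => ?_
  rw [map_smul, map_smul,
    HausdorffMomentBernsteinIdentity.linearMap_X_pow_mul_one_sub_X_pow L a hL, smul_eq_mul,
    smul_eq_mul]

end Literature.MeasureTheory.Integral
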